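import Summits.CriticalPhenomena.Ising3DConformalLimit.Theorems.HarmonicMomentsIsotropyDilutionTransferInvariance
import Summits.CriticalPhenomena.Ising3DConformalLimit.Theorems.HarmonicMomentsIsotropyDilutionTransferNuB2

/-!
# The dilution line of `TwoPointAsymptoticIsotropy` with a RADIAL regularity input, I:
# shells are charged, and invariant weak limits of the scaled subcritical measures
(route HarmonicMomentsIsotropy, support item stmt-CriticalPhenomena-6036 `TwoPointAsymptoticIsotropy`;
helpers of `twoPointAsymptoticIsotropy_of_dilution_shellCharging`, file `…OfDilutionShell`)

The dilution line (`…TwoPointAsymptoticIsotropyOfDilution`) derives vague asymptotic `O(3)`-isotropy of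
`⟨σ₀σ_x⟩_{β_c}` on `ℤ³` from harmonic dilution (HD), the `ξ₂`-window (CLW) and CUBE charging of the
critical mass.  The angular part of cube charging is superfluous: the weak limits of the scaled
subcritical measures `ν_β` are `O(3)`-invariant, so a charged Euclidean SHELL forces every cube
inside it to be charged.  This file supplies the two inputs of that argument:

* `nu_shell_charge_of_shellCharging` — SHELL CHARGING of the critical mass (for `0 < ρ₁ < ρ₂`
  there are `q, δ₀ > 0` with `q ∑_{‖δx‖_∞ ≤ 1} ⟨σ₀σₓ⟩_{β_c} ≤ ∑_{ρ₁ ≤ |δx| ≤ ρ₂} ⟨σ₀σₓ⟩_{β_c}` for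
  `0 < δ < δ₀`, `|·|` Euclidean) together with CLW gives `ν_β{ρ₁ ≤ ‖y‖ ≤ ρ₂} ≥ ι > 0` for `β` near
  `β_c` (the proof of `nu_charge`, `…DilutionTransferNuB2`, with shells for cubes);
* `exists_invariant_weakLimit` — under HD and CLW (ii), every sequence `β_j ↑ β_c` has a subsequence
  along which `ν_{β_j}` converges weakly to a probability measure invariant under ALL linear
  isometries of `ℝ³` (the first two thirds of the proof of `asymptotic_invariance`,
  `…DilutionTransferInvariance`: Prokhorov under a uniform exponential moment, moment convergence,
  Fischer decomposition, moment determinacy).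

No definitions, no named facts; axioms standard.
-/

noncomputable section

open MeasureTheory Filter Topology Set MvPolynomial
open scoped ENNReal NNReal BigOperators RealInnerProductSpace BoundedContinuousFunction
open Literature.Probability.LatticeModels

namespace Summit.CriticalPhenomena.Ising3DConformalLimit.Theorems.HarmonicMomentsIsotropy

open scoped Classical

/-! ## Shell charging of the critical mass charges the shells of `ν_β` -/

/-- **The scaled two-point measures charge Euclidean shells, from shell charging.** Assume SHELL
CHARGING of the critical two-point mass: for `0 < ρ₁ < ρ₂` there are `q > 0`, `δ₀ > 0` with
`q ∑_{‖δx‖_∞ ≤ 1} ⟨σ₀σₓ⟩_{β_c} ≤ ∑_{ρ₁² ≤ δ²|x|² ≤ ρ₂²} ⟨σ₀σₓ⟩_{β_c}` for `0 < δ < δ₀`.  Then, given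
CLW (i) at `ε = 1/2` (scale `s₁`, from `β₁`) and CLW (ii) (from `β₀`), every shell
`{ρ₁ ≤ ‖y‖ ≤ ρ₂}` with `0 < ρ₁ < ρ₂`, `ρ₂² ≤ s₁` has `ν_β`-mass at least a fixed `ι > 0` for all
`β` close to `β_c`. -/
theorem nu_shell_charge_of_shellCharging
    (hS : ∀ ρ₁ ρ₂ : ℝ, 0 < ρ₁ → ρ₁ < ρ₂ → ∃ q : ℝ, 0 < q ∧ ∃ δ₀ : ℝ, 0 < δ₀ ∧
      ∀ δ : ℝ, 0 < δ → δ < δ₀ →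
        q * (∑' x : Site 3, if (δ • fun i => ((x i : ℤ) : ℝ)) ∈
            Metric.closedBall (0 : Fin 3 → ℝ) 1 then criticalTwoPoint 3 x else 0) ≤
          ∑' x : Site 3, (if ρ₁ ^ 2 ≤ δ ^ 2 * (∑ i, ((x i : ℤ) : ℝ) ^ 2) ∧
            δ ^ 2 * (∑ i, ((x i : ℤ) : ℝ) ^ 2) ≤ ρ₂ ^ 2 then criticalTwoPoint 3 x else 0))
    {s₁ β₁ : ℝ} (hβ₁ : β₁ < criticalBeta 3)
    (hi : ∀ β : ℝ, β₁ ≤ β → β < criticalBeta 3 → ∀ x : Site 3,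
      (∑ i, ((x i : ℤ) : ℝ) ^ 2) * chi β ≤ s₁ * msq β →
        (1 / 2 : ℝ) * criticalTwoPoint 3 x ≤ twoPointFree 3 β x)
    {c₀ C β₀ : ℝ} (hc₀ : 0 < c₀) (hβ₀ : β₀ < criticalBeta 3)
    (hii : ∀ β : ℝ, β₀ ≤ β → β < criticalBeta 3 → ∀ A : ℝ, 1 ≤ A →
      (∑' x : Site 3, if A ^ 2 * msq β < (∑ i, ((x i : ℤ) : ℝ) ^ 2) * chi β
        then twoPointFree 3 β x else 0) ≤ C * Real.exp (-(c₀ * A)) * chi β)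
    {ρ₁ ρ₂ : ℝ} (hρ₁ : 0 < ρ₁) (hρ₁₂ : ρ₁ < ρ₂) (hρ₂ : ρ₂ ^ 2 ≤ s₁) :
    ∃ ι > 0, ∀ᶠ β in 𝓝[<] (criticalBeta 3),
      ι ≤ ((nu β) {y : V | ρ₁ ≤ ‖y‖ ∧ ‖y‖ ≤ ρ₂}).toReal := by
  have hρ₂pos : 0 < ρ₂ := hρ₁.trans hρ₁₂
  obtain ⟨A₀, hA₀1, hA₀⟩ := exists_tail_scale hc₀ C
  have hA₀pos : 0 < A₀ := lt_of_lt_of_le one_pos hA₀1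
  obtain ⟨q, hq, δq, hδq, hdoub⟩ := hS (ρ₁ / A₀) (ρ₂ / A₀) (by positivity)
    (div_lt_div_of_pos_right hρ₁₂ hA₀pos)
  refine ⟨q / 4, by positivity, ?_⟩
  -- good `β`: close to `β_c` and `ξ₂` large
  have hξ := tendsto_xi_atTop hc₀ hβ₀ hii
  have hgood : ∀ᶠ β in 𝓝[<] (criticalBeta 3), max (max β₀ β₁) 0 < β ∧ β < criticalBeta 3 := by
    have : Ioo (max (max β₀ β₁) 0) (criticalBeta 3) ∈ 𝓝[<] (criticalBeta 3) :=
      Ioo_mem_nhdsLT (max_lt (max_lt hβ₀ hβ₁) (criticalBeta_pos_holds (d := 3) (by norm_num)))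
    filter_upwards [this] with β hβ using hβ
  filter_upwards [hgood, hξ.eventually_gt_atTop ((A₀ * δq)⁻¹)] with β hβ hξβ
  have hβ0 : 0 < β := lt_of_le_of_lt (le_max_right _ _) hβ.1
  have hβc : β < criticalBeta 3 := hβ.2
  have hββ₀ : β₀ ≤ β := ((le_max_left _ _).trans (le_max_left _ _)).trans hβ.1.le
  have hββ₁ : β₁ ≤ β := ((le_max_right _ _).trans (le_max_left _ _)).trans hβ.1.le
  have hχ := chi_pos hβ0.le hβc
  have hξpos := xi_pos hβ0 hβc
  set ξ : ℝ := xi β with hξdef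
  set δ : ℝ := (A₀ * ξ)⁻¹ with hδ
  have hδpos : 0 < δ := by positivity
  have hδq' : δ < δq := by
    rw [hδ, inv_lt_comm₀ (by positivity) hδq]
    calc δq⁻¹ = (A₀ * δq)⁻¹ * A₀ := by field_simp
      _ < ξ * A₀ := mul_lt_mul_of_pos_right hξβ hA₀pos
      _ = A₀ * ξ := mul_comm _ _
  -- (1) the measure of the shell as a lattice sum
  have hmeas : ((nu β) {y : V | ρ₁ ≤ ‖y‖ ∧ ‖y‖ ≤ ρ₂}).toReal = (chi β)⁻¹ *
      ∑' x : Site 3, (if ρ₁ ≤ ‖ξ⁻¹ • siteV x‖ ∧ ‖ξ⁻¹ • siteV x‖ ≤ ρ₂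
        then twoPointFree 3 β x else 0) := by
    rw [nu_apply_toReal hβ0.le hβc, ENNReal.toReal_ofReal]
    · rfl
    · exact mul_nonneg (inv_nonneg.2 hχ.le) (tsum_nonneg fun x => by
        split_ifs; exacts [IsingInputs.G_nonneg hβ0.le x, le_refl _])
  -- (2) the shell condition at scale `ξ₂` is the shell condition at mesh `δ` for `ρᵢ/A₀`
  have hshell : ∀ x : Site 3, ((ρ₁ / A₀) ^ 2 ≤ δ ^ 2 * (∑ i, ((x i : ℤ) : ℝ) ^ 2) ∧
      δ ^ 2 * (∑ i, ((x i : ℤ) : ℝ) ^ 2) ≤ (ρ₂ / A₀) ^ 2) →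
      (ρ₁ ≤ ‖ξ⁻¹ • siteV x‖ ∧ ‖ξ⁻¹ • siteV x‖ ≤ ρ₂) := by
    intro x hx
    have e1 : ‖ξ⁻¹ • siteV x‖ = A₀ * (δ * ‖siteV x‖) := by
      rw [norm_smul, Real.norm_eq_abs, abs_of_pos (inv_pos.2 hξpos), hδ]
      field_simp
    have e2 : δ ^ 2 * (∑ i, ((x i : ℤ) : ℝ) ^ 2) = (δ * ‖siteV x‖) ^ 2 := by
      rw [mul_pow, norm_siteV_sq]
    rw [e2] at hx
    have hu : 0 ≤ δ * ‖siteV x‖ := by positivity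
    obtain ⟨h1, h2⟩ := hx
    rw [pow_le_pow_iff_left₀ (a := ρ₁ / A₀) (by positivity) hu two_ne_zero] at h1
    rw [pow_le_pow_iff_left₀ (b := ρ₂ / A₀) hu (by positivity) two_ne_zero] at h2
    rw [e1]
    constructor
    · rw [div_le_iff₀ hA₀pos] at h1; linarith
    · rw [le_div_iff₀ hA₀pos] at h2; linarith
  -- (3) CLW (i): on the shell `G_β ≥ G_c/2`
  have hlow : (∑' x : Site 3, if ((ρ₁ / A₀) ^ 2 ≤ δ ^ 2 * (∑ i, ((x i : ℤ) : ℝ) ^ 2) ∧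
      δ ^ 2 * (∑ i, ((x i : ℤ) : ℝ) ^ 2) ≤ (ρ₂ / A₀) ^ 2)
      then (1 / 2 : ℝ) * criticalTwoPoint 3 x else 0) ≤
      ∑' x : Site 3, (if ρ₁ ≤ ‖ξ⁻¹ • siteV x‖ ∧ ‖ξ⁻¹ • siteV x‖ ≤ ρ₂
        then twoPointFree 3 β x else 0) := by
    refine tsum_ite_le_tsum_ite hshell (fun x => by positivity [criticalTwoPoint_nonneg' x])
      (fun x hx => ?_) (fun x => IsingInputs.G_nonneg hβ0.le x) (summable_ite_G hβ0.le hβc _)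
    refine hi β hββ₁ hβc x ?_
    -- `|x|² χ ≤ ρ₂² ξ² χ ≤ s₁ M₂`
    have hx2 := (hshell x hx).2
    rw [norm_smul, Real.norm_eq_abs, abs_of_pos (inv_pos.2 hξpos), ← div_eq_inv_mul,
      div_le_iff₀ hξpos] at hx2
    have hr2 : (∑ i, ((x i : ℤ) : ℝ) ^ 2) ≤ (ρ₂ * ξ) ^ 2 := by
      rw [← norm_siteV_sq]
      exact pow_le_pow_left₀ (norm_nonneg _) hx2 2
    have hξ2 : ξ ^ 2 * chi β = msq β := by
      rw [hξdef, xi_sq hβ0.le hβc]; field_simp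
    calc (∑ i, ((x i : ℤ) : ℝ) ^ 2) * chi β ≤ (ρ₂ * ξ) ^ 2 * chi β :=
        mul_le_mul_of_nonneg_right hr2 hχ.le
      _ = ρ₂ ^ 2 * (ξ ^ 2 * chi β) := by ring
      _ ≤ s₁ * msq β := by rw [hξ2]; exact mul_le_mul_of_nonneg_right hρ₂ (msq_nonneg hβ0.le)
  have hlow' : (∑' x : Site 3, if ((ρ₁ / A₀) ^ 2 ≤ δ ^ 2 * (∑ i, ((x i : ℤ) : ℝ) ^ 2) ∧
      δ ^ 2 * (∑ i, ((x i : ℤ) : ℝ) ^ 2) ≤ (ρ₂ / A₀) ^ 2)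
      then (1 / 2 : ℝ) * criticalTwoPoint 3 x else 0) = 1 / 2 * ∑' x : Site 3,
        (if ((ρ₁ / A₀) ^ 2 ≤ δ ^ 2 * (∑ i, ((x i : ℤ) : ℝ) ^ 2) ∧
          δ ^ 2 * (∑ i, ((x i : ℤ) : ℝ) ^ 2) ≤ (ρ₂ / A₀) ^ 2)
          then criticalTwoPoint 3 x else 0) := by
    rw [← tsum_mul_left]; refine tsum_congr fun x => ?_; split_ifs <;> ring
  -- (4) shell charging at mesh `δ`
  have hd := hdoub δ hδpos hδq'
  -- (5) the ball sum dominates the head sum, which is `≥ χ/2`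
  have hhead : (∑' x : Site 3, if ¬(A₀ ^ 2 * msq β < (∑ i, ((x i : ℤ) : ℝ) ^ 2) * chi β)
      then twoPointFree 3 β x else 0) ≤
      ∑' x : Site 3, (if (δ • fun i => ((x i : ℤ) : ℝ)) ∈ Metric.closedBall (0 : Fin 3 → ℝ) 1
        then criticalTwoPoint 3 x else 0) := by
    refine tsum_ite_le_tsum_ite (fun x hx => ?_) (fun x => IsingInputs.G_nonneg hβ0.le x)
      (fun x _ => IsingInputs.G_le_critical hβ0.le hβc.le x) (fun x => criticalTwoPoint_nonneg' x)
      (LatticeSums.summable_norm_ite_mem hδpos subset_rfl _).of_norm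
    have hn := norm_le_of_not_tail hβ0 hβc (zero_le_one.trans hA₀1) hx
    rw [Metric.mem_closedBall, dist_zero_right, norm_smul, Real.norm_eq_abs, abs_of_pos hδpos,
      LatticeSums.norm_intCast_eq, hδ, ← div_eq_inv_mul, div_le_one (by positivity)]
    exact hn
  have hchi2 := chi_le_two_mul_head hβ0 hβc (hii β hββ₀ hβc A₀ hA₀1) hA₀
  -- (6) assemble: `ν(shell) ≥ χ⁻¹ · (1/2) · q · ballSum ≥ q/4`
  rw [hmeas]
  have hball_ge : chi β / 2 ≤ ∑' x : Site 3, (if (δ • fun i => ((x i : ℤ) : ℝ)) ∈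
      Metric.closedBall (0 : Fin 3 → ℝ) 1 then criticalTwoPoint 3 x else 0) := by linarith
  have key : q / 4 * chi β ≤ ∑' x : Site 3, (if ρ₁ ≤ ‖ξ⁻¹ • siteV x‖ ∧ ‖ξ⁻¹ • siteV x‖ ≤ ρ₂
      then twoPointFree 3 β x else 0) := by
    calc q / 4 * chi β = 1 / 2 * (q * (chi β / 2)) := by ring
      _ ≤ 1 / 2 * (q * ∑' x : Site 3, (if (δ • fun i => ((x i : ℤ) : ℝ)) ∈
          Metric.closedBall (0 : Fin 3 → ℝ) 1 then criticalTwoPoint 3 x else 0)) := by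
          gcongr
      _ ≤ 1 / 2 * ∑' x : Site 3, (if ((ρ₁ / A₀) ^ 2 ≤ δ ^ 2 * (∑ i, ((x i : ℤ) : ℝ) ^ 2) ∧
          δ ^ 2 * (∑ i, ((x i : ℤ) : ℝ) ^ 2) ≤ (ρ₂ / A₀) ^ 2)
          then criticalTwoPoint 3 x else 0) := by
          gcongr
      _ ≤ _ := by rw [← hlow']; exact hlow
  rw [le_inv_mul_iff₀ hχ]
  linarith

/-! ## Invariant weak limits of the scaled subcritical measures -/

/-- **Invariant weak limits of `ν_β`.**  Under harmonic dilution (all cubic-harmonic anisotropy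
ratios of the subcritical two-point function tend to `0` as `β ↑ β_c`) and the one-length window
CLW (ii), every sequence `β_j → β_c⁻` has a tail `j ≥ J` inside `(0, β_c)` and a subsequence along
which the probability measures `ν_{β_j}` converge weakly to a probability measure `μ` on Euclidean
`ℝ³` that is invariant under every linear isometry (`O(3)`, reflections included): Prokhorov (the
exponential moments are uniform), moment convergence, vanishing of all harmonic moments of `μ`,
radial marginal moments by the Fischer decomposition, and moment determinacy under an exponential
moment. -/
theorem exists_invariant_weakLimit
    (hHD : ∀ (n m : ℕ) (Y : MvPolynomial (Fin 3) ℝ), 1 ≤ n → Y.IsHomogeneous n →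
      (∑ i : Fin 3, pderiv i (pderiv i Y)) = 0 →
      Tendsto (fun β => (∑' x : Site 3, eval (fun i => ((x i : ℤ) : ℝ)) Y *
          Real.sqrt (∑ i, ((x i : ℤ) : ℝ) ^ 2) ^ (2 * m) * twoPointFree 3 β x) /
        (∑' x : Site 3, Real.sqrt (∑ i, ((x i : ℤ) : ℝ) ^ 2) ^ (n + 2 * m) * twoPointFree 3 β x))
        (𝓝[<] (criticalBeta 3)) (𝓝 0))
    {c₀ C β₀ : ℝ} (hc₀ : 0 < c₀) (hβ₀ : β₀ < criticalBeta 3)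
    (hii : ∀ β : ℝ, β₀ ≤ β → β < criticalBeta 3 → ∀ A : ℝ, 1 ≤ A →
      (∑' x : Site 3, if A ^ 2 * msq β < (∑ i, ((x i : ℤ) : ℝ) ^ 2) * chi β
        then twoPointFree 3 β x else 0) ≤ C * Real.exp (-(c₀ * A)) * chi β)
    {ns : ℕ → ℝ} (hns : Tendsto ns atTop (𝓝[<] (criticalBeta 3))) :
    ∃ (J : ℕ) (φ' : ℕ → ℕ) (μs : ℕ → ProbabilityMeasure V) (μ : ProbabilityMeasure V),
      StrictMono φ' ∧ (∀ j, ((μs j : ProbabilityMeasure V) : Measure V) = nu (ns (J + φ' j))) ∧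
      Tendsto μs atTop (𝓝 μ) ∧
      ∀ T : V ≃ₗᵢ[ℝ] V, (μ : Measure V).map T = μ := by
  obtain ⟨K, hK⟩ := nu_exp_moment hc₀ hii
  set βs : ℝ := max β₀ 0 with hβs_def
  have hβs : βs < criticalBeta 3 := max_lt hβ₀ (criticalBeta_pos_holds (d := 3) (by norm_num))
  -- eventually the sequence is in the good range
  have hev : ∀ᶠ j in atTop, ns j ∈ Ioo βs (criticalBeta 3) := hns.eventually (Ioo_mem_nhdsLT hβs)
  obtain ⟨J, hJ⟩ := eventually_atTop.1 hev
  have hgood : ∀ j, βs < ns (J + j) ∧ ns (J + j) < criticalBeta 3 := fun j => hJ _ (by omega)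
  have hpos : ∀ j, 0 < ns (J + j) := fun j => lt_of_le_of_lt (le_max_right _ _) (hgood j).1
  have hge : ∀ j, β₀ ≤ ns (J + j) := fun j => (le_max_left _ _).trans (hgood j).1.le
  -- the probability measures
  set νs : ℕ → ProbabilityMeasure V := fun j =>
    ⟨nu (ns (J + j)), isProbabilityMeasure_nu (hpos j).le (hgood j).2⟩ with hνs
  have hexp : ∀ j, Integrable (fun y : V => Real.exp (c₀ / 2 * ‖y‖)) (νs j : Measure V) ∧
      ∫ y, Real.exp (c₀ / 2 * ‖y‖) ∂(νs j : Measure V) ≤ K := fun j =>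
    hK _ (hge j) (hpos j) (hgood j).2
  have hc2 : 0 < c₀ / 2 := by positivity
  obtain ⟨μ, φ', hφ', hlimμ⟩ := WeakLimit.exists_subseq_tendsto_of_exp_moment hc2
    (fun j => (hexp j).1) (fun j => (hexp j).2)
  obtain ⟨hintμ, hKμ⟩ := WeakLimit.exp_moment_le_of_tendsto hlimμ (fun j => (hexp (φ' j)).1)
    (fun j => (hexp (φ' j)).2)
  -- the subsequence of inverse temperatures still tends to `β_c⁻`
  have hsub : Tendsto (fun j => ns (J + φ' j)) atTop (𝓝[<] (criticalBeta 3)) := by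
    refine hns.comp ?_
    exact tendsto_atTop_mono (fun j => Nat.le_add_left _ _) hφ'.tendsto_atTop
  -- (1) the weak limit kills all harmonic moments
  have hharmμ : ∀ (n m : ℕ) (Y : MvPolynomial (Fin 3) ℝ), 1 ≤ n → Y.IsHomogeneous n →
      (∑ i : Fin 3, pderiv i (pderiv i Y)) = 0 →
      ∫ y, ‖y‖ ^ (2 * m) * eval (fun i => y i) Y ∂(μ : Measure V) = 0 := by
    intro n m Y hn hY hlap
    set g : V → ℝ := fun y => eval (fun i => y i) Y * ‖y‖ ^ (2 * m) with hg
    have hgc : Continuous g :=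
      ((continuous_eval Y).comp (by fun_prop : Continuous fun y : V => fun i => y i)).mul
        (continuous_norm.pow _)
    obtain ⟨-, A', -, hA'⟩ := growth_bounds hY m hc₀
    have hA'' : ∀ y : V, g y ^ 2 ≤ A' * Real.exp (c₀ / 2 * ‖y‖) := fun y => by
      rw [hg]; dsimp only; rw [mul_comm]; exact hA' y
    have h1 : Tendsto (fun j => ∫ y, g y ∂(νs (φ' j) : Measure V)) atTop
        (𝓝 (∫ y, g y ∂(μ : Measure V))) :=
      WeakLimit.tendsto_integral_of_sq_le_exp_moment hlimμ hgc hA''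
        (fun j => (hexp (φ' j)).1) (fun j => (hexp (φ' j)).2) hintμ hKμ
    set q : ℕ := n + 2 * m with hq
    have hradial_bd : ∀ j, |∫ y, ‖y‖ ^ q ∂(νs (φ' j) : Measure V)| ≤
        (q.factorial : ℝ) * (2 / c₀) ^ q * K := by
      intro j
      have hnn : 0 ≤ ∫ y, ‖y‖ ^ q ∂(νs (φ' j) : Measure V) := integral_nonneg fun y => by positivity
      rw [abs_of_nonneg hnn]
      calc ∫ y, ‖y‖ ^ q ∂(νs (φ' j) : Measure V)
          ≤ ∫ y, (q.factorial : ℝ) * (2 / c₀) ^ q * Real.exp (c₀ / 2 * ‖y‖)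
              ∂(νs (φ' j) : Measure V) := by
            refine integral_mono_of_nonneg (ae_of_all _ fun y => by positivity)
              ((hexp (φ' j)).1.const_mul _) (ae_of_all _ fun y => ?_)
            exact IsingInputs.pow_le_factorial_mul_exp hc₀ q (norm_nonneg y)
        _ = (q.factorial : ℝ) * (2 / c₀) ^ q *
              ∫ y, Real.exp (c₀ / 2 * ‖y‖) ∂(νs (φ' j) : Measure V) := integral_const_mul _ _
        _ ≤ (q.factorial : ℝ) * (2 / c₀) ^ q * K :=
            mul_le_mul_of_nonneg_left (hexp (φ' j)).2 (by positivity)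
    have h2 : Tendsto (fun j => ∫ y, g y ∂(νs (φ' j) : Measure V)) atTop (𝓝 0) := by
      have ha := (hHD n m Y hn hY hlap).comp hsub
      have heq : ∀ j, ∫ y, g y ∂(νs (φ' j) : Measure V) =
          (∑' x : Site 3, eval (fun i => ((x i : ℤ) : ℝ)) Y *
              Real.sqrt (∑ i, ((x i : ℤ) : ℝ) ^ 2) ^ (2 * m) * twoPointFree 3 (ns (J + φ' j)) x) /
            (∑' x : Site 3, Real.sqrt (∑ i, ((x i : ℤ) : ℝ) ^ 2) ^ (n + 2 * m) *
              twoPointFree 3 (ns (J + φ' j)) x) *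
          ∫ y, ‖y‖ ^ q ∂(νs (φ' j) : Measure V) := fun j =>
        integral_harmonicMoment_eq (hpos (φ' j)).le (hgood (φ' j)).2 hn hY m
      refine squeeze_zero_norm (fun j => ?_) ?_ (a := fun j =>
        ‖(∑' x : Site 3, eval (fun i => ((x i : ℤ) : ℝ)) Y *
              Real.sqrt (∑ i, ((x i : ℤ) : ℝ) ^ 2) ^ (2 * m) * twoPointFree 3 (ns (J + φ' j)) x) /
            (∑' x : Site 3, Real.sqrt (∑ i, ((x i : ℤ) : ℝ) ^ 2) ^ (n + 2 * m) *
              twoPointFree 3 (ns (J + φ' j)) x)‖ * ((q.factorial : ℝ) * (2 / c₀) ^ q * K))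
      · rw [heq j, norm_mul]
        exact mul_le_mul_of_nonneg_left (by rw [Real.norm_eq_abs]; exact hradial_bd j)
          (norm_nonneg _)
      · have := ha.norm.mul_const ((q.factorial : ℝ) * (2 / c₀) ^ q * K)
        simpa using this
    have h3 := tendsto_nhds_unique h1 h2
    rw [hg] at h3
    rw [← h3]
    exact integral_congr_ae (ae_of_all _ fun y => by simp only; ring)
  -- (2) hence the marginal moments of the limit are radial, and the limit is invariant
  haveI : IsProbabilityMeasure (μ : Measure V) := μ.prop
  have hrad : ∀ ξ ξ' : V, ‖ξ‖ = ‖ξ'‖ → ∀ k : ℕ,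
      ∫ y, ⟪y, ξ⟫ ^ k ∂(μ : Measure V) = ∫ y, ⟪y, ξ'⟫ ^ k ∂(μ : Measure V) :=
    fun ξ ξ' h k => inner_moments_radial (integrable_poly_of_exp_moment hc₀ hintμ) hharmμ ξ ξ' h k
  refine ⟨J, φ', fun j => νs (φ' j), μ, hφ', fun j => rfl, hlimμ, fun T => ?_⟩
  exact Determinacy.map_linearIsometryEquiv_eq_self_of_radial_moments hc2 hintμ hrad T

end Summit.CriticalPhenomena.Ising3DConformalLimit.Theorems.HarmonicMomentsIsotropy

end
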